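/-
Copyright (c) 2026 the pub-hodgecm-mathlib formalisation cell (harness21).  Prover seat hodgecm-mathlib-K2E4-p09 (g3), Track B «K2-LIT» ∕ h413, road (d-w) of ‹J3› v2, letter (C-ratio),
brick (C1-I) «IWAHORI LEVEL COUNT» (road owner K2E3-p03 (g3) ORDERS 2026-09-04T03:29:34Z), FILE 2: the three index identities of the chain `K(4) ≤ N(𝒪⁻)K(4) ≤ B(4) ≤ I`.  2026-09-04.
-/
import Literature.NumberTheory.Automorphic.UnitaryTwoAntidiagIwahoriCosets     -- ★ FILE 1 (this seat): coset count, inverse entries, `n`, `n̄`, `t`, the level subgroups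
import Literature.NumberTheory.Automorphic.UnitaryLatticeTreeWeightedGauss   -- ★ `UnitaryLatticeTree.v_eq_one_of_v_sub_one_lt_one` (`|x − 1| < 1 ⇒ |x| = 1`)
import HarnessLib

/-!
# The Iwahori factorisation of `I ≤ U(σ, antidiag(1,1))(𝒪)` read as three indices:
# `[N(𝒪⁻)K(4) : K(4)] = [𝒪⁻ : (4𝒪)⁻]`, `[B(4) : N(𝒪⁻)K(4)] = [𝒪^× : 1 + 4𝒪]`, `[I : B(4)] = [𝔪⁻ : (4𝒪)⁻]`, hence `[I : K(4)] = [𝔪⁻ : (4𝒪)⁻]·[𝒪^× : 1+4𝒪]·[𝒪⁻ : (4𝒪)⁻]`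
# (Tits 1979 §3.3.1, §3.7; Cartier 1979 §III.5; Serre, *Local Fields* IV §2)

Topic `NumberTheory/Automorphic`; namespace `Literature.NumberTheory.Automorphic.UnitaryGroup`.  THEOREMS ONLY (no definition, no instance, no notation, no named fact, no `sorry`);
kernel lane `--supports stmt-HodgeConjecture-24833`.  Cell `pub/hodgecm-mathlib`, Track B «K2-LIT», crux H413; road (d-w) of ‹J3› v2 (owner K2E3-p03 (g3)), letter (C-ratio) ⟸ (C1)+(C2),
brick **(C1-I) «IWAHORI LEVEL COUNT»** (`K2/K2E3-p03/g3/TARGETS-Cratio.K2E3-p03-g3.md`: `[I : K⁰(4)] = (q−1)q^{8m−2}` √u ∕ `(q−1)q^{8m−1}` √π).  FILE 1 ★ `UnitaryTwoAntidiagIwahoriCosets` =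
coset bookkeeping; THIS FILE = the field-generic INDEX IDENTITIES (valued field `K`, `σ` an isometric involution, `|4| < 1`); FILE 3 (Summits-side) = the CM dress + the numbers
`q^{2m−1+s}·(q−1)q^{4m−1}·q^{2m}`.  All subgroups are BINDERS with membership letters: `K(4)`, `I` ≤ `GL₂(K)` (letters of FILE 1), the skew balls `𝒪⁻ = {σx = −x, |x| ≤ 1}`, `𝔪⁻ = {σx = −x,
|x| < 1}`, `(4𝒪)⁻ = {σx = −x, |x| ≤ |4|}` ≤ `(K, +)`, and the unit levels `𝒪^× = {|e| = 1}`, `1 + 4𝒪 = {|e| = 1, |e − 1| ≤ |4|}` ≤ `K^×` (the letters of ★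
`WildQuadraticDatum.relIndex_unitLevel_eq` and of the (L) KIT `relIndex_skewBall_eq_pow_of_antifixed`).

THE MATHEMATICS (IWAHORI FACTORISATION `k = n̄(c∕a)·t(a)·n(b∕a)` of `k = (a b; c d) ∈ I`, `c∕a`, `b∕a` skew by ★ `antidiagTwo_entry_relations`).  Each step of the chain
`K(4) ≤ H₁ = N(𝒪⁻)K(4) ≤ H₂ = B(4) ≤ I` is `H₁ = φ(B)·H₀` for a one-parameter homomorphism `φ ∈ {n, t, n̄}` of ★ FILE 1, with `φ(b) ∈ H₀ ↔ b ∈ B₀`, so ★ FILE 1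
`relIndex_eq_relIndex_of_mul_decomposition` gives `[H₁ : H₀] = [B : B₀]`:
* §1 `K(4) ≤ H₁`, `φ = n`, `B = 𝒪⁻`, `B₀ = (4𝒪)⁻`: for `h ∈ H₁` (`a ≡ d ≡ 1`, `c ≡ 0`), `x := b∕d` is skew integral and `n(x)⁻¹h = (a − xc, 0; c, d) ∈ K(4)` — **`[H₁ : K(4)] = [𝒪⁻ : (4𝒪)⁻]`**
  (`relIndex_principalLevel_unitriangularLevel_eq`);
* §2 `H₁ ≤ H₂`, `φ = t`, `B = 𝒪^×`, `B₀ = 1 + 4𝒪`: for `h ∈ H₂`, `|a| = 1` (★ `valued_apply_zero_zero_eq_one_or_of_integral`) and `t(a)⁻¹h = (1, b∕a; σa·c, σa·d)` with `σa·d − 1 = −σc·b ≡ 0`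
  — **`[H₂ : H₁] = [𝒪^× : 1 + 4𝒪]`** (`relIndex_unitriangularLevel_borelLevel_eq`; `t(e) ∈ H₁ ↔ |e − 1| ≤ |4|` uses `|(σe)⁻¹ − 1| = |e − 1|`);
* §3 `H₂ ≤ I`, `φ = n̄`, `B = 𝔪⁻`, `B₀ = (4𝒪)⁻`: for `k ∈ I` (`|c| < 1`, `|a| = 1`), `x := c∕a ∈ 𝔪⁻` and `n̄(x)⁻¹k = (a b; 0, d − xb) ∈ B(4)` — **`[I : H₂] = [𝔪⁻ : (4𝒪)⁻]`**
  (`relIndex_borelLevel_iwahori_eq`);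
* §4 the product **`[I : K(4)] = [𝔪⁻ : (4𝒪)⁻] · [𝒪^× : 1 + 4𝒪] · [𝒪⁻ : (4𝒪)⁻]`** (`relIndex_principalLevel_iwahori_eq_mul`, the intermediate levels discharged by ★ FILE 1's existence lemmas).
HONEST LABEL: count-neutral field∕group algebra; HC_CM is proved only modulo the 7 printed citations (2 remaining named inputs: hLiu418 = `stmt-HodgeConjecture-24832`, h413 =
`stmt-HodgeConjecture-24833`) until rung 0 closes; (C1)∕(C-ratio) are NOT proved here (the three abelian indices are evaluated in FILE 3).

## References
* [Tits1979] J. Tits, *Reductive groups over local fields*, PSPM 33.1 (1979), §3.3.1, §3.7 (Iwahori subgroups and their big-cell factorisation).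
* [CartierCorvallis1979] P. Cartier, *Representations of 𝔭-adic groups: a survey*, PSPM 33.1 (1979), §III.5.
* [Serre1979] J.-P. Serre, *Local Fields*, GTM 67 (1979), Ch. IV §2 Prop. 6.
* [Rogawski1990] J. D. Rogawski, *Automorphic Representations of Unitary Groups in Three Variables*, Ann. of Math. Stud. 123 (1990), §1.9–§1.10 pp. 8–9.
-/

set_option autoImplicit false

open scoped Matrix MatrixGroups
open Matrix WithZero

namespace Literature.NumberTheory.Automorphic

namespace UnitaryGroup

section Indices

variable {K : Type*} [Field K] (σ : K →+* K) [Valued K ℤᵐ⁰] (hσ : ∀ x, σ (σ x) = x) (hvσ : ∀ x, Valued.v (σ x) = Valued.v x)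

omit [Valued K ℤᵐ⁰] in
/-- Entries of a `GL₂` element from its matrix. [cite: Rogawski1990, §1.9 p. 8] -/
theorem apply_eq_of_coe_eq {g : GL (Fin 2) K} {a b c d : K} (h : (g : Matrix (Fin 2) (Fin 2) K) = !![a, b; c, d]) :
    (g 0 0 : K) = a ∧ (g 0 1 : K) = b ∧ (g 1 0 : K) = c ∧ (g 1 1 : K) = d := by
  refine ⟨?_, ?_, ?_, ?_⟩ <;> simp [h]

include hvσ in
/-- `|(σe)⁻¹ − 1| = |e − 1|` for a unit `e` (`(σe)⁻¹ − 1 = σ(1 − e)·(σe)⁻¹`). [cite: Serre1979, Ch. IV §2] -/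
theorem valued_inv_map_sub_one_eq {e : K} (he : Valued.v e = 1) : Valued.v ((σ e)⁻¹ - 1) = Valued.v (e - 1) := by
  have he0 : e ≠ 0 := fun h0 => by rw [h0, map_zero] at he; exact zero_ne_one he
  have hσe : σ e ≠ 0 := (map_ne_zero σ).2 he0
  rw [show (σ e)⁻¹ - 1 = σ (1 - e) * (σ e)⁻¹ by rw [map_sub, map_one]; field_simp, map_mul, map_inv₀, hvσ, hvσ, he, inv_one, mul_one,
    Valuation.map_sub_swap]

/-! ## §1 `[N(𝒪⁻)K(4) : K(4)] = [𝒪⁻ : (4𝒪)⁻]` -/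

/-- **`[N(𝒪⁻)·K(4) : K(4)] = [𝒪⁻ : (4𝒪)⁻]`** (`|4| < 1`): the step `K(4) ≤ H₁` of the Iwahori chain is `H₁ = n(𝒪⁻)·K(4)` with `n(x) ∈ K(4) ↔ x ∈ (4𝒪)⁻` — for `h = (a b; c d) ∈ H₁`,
`x = b∕d` is skew (`σb·d + σd·b = 0`) integral and `n(x)⁻¹·h = (a − xc, 0; c, d) ≡ 1 (4)`. [cite: Tits1979, §3.3.1] [cite: CartierCorvallis1979, §III.5] -/
theorem relIndex_principalLevel_unitriangularLevel_eq (h4 : Valued.v (4 : K) < 1) {K4 H1 : Subgroup (GL (Fin 2) K)}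
    (hK4 : ∀ g, g ∈ K4 ↔ (g ∈ unitaryGroupOfForm σ !![(0 : K), 1; 1, 0] ∧ ∀ i j, Valued.v (g i j : K) ≤ 1) ∧
      ∀ i j, Valued.v ((g i j : K) - (1 : Matrix (Fin 2) (Fin 2) K) i j) ≤ Valued.v (4 : K))
    (hH1 : ∀ g, g ∈ H1 ↔ (g ∈ unitaryGroupOfForm σ !![(0 : K), 1; 1, 0] ∧ ∀ i j, Valued.v (g i j : K) ≤ 1) ∧
      Valued.v ((g 0 0 : K) - 1) ≤ Valued.v (4 : K) ∧ Valued.v ((g 1 1 : K) - 1) ≤ Valued.v (4 : K) ∧ Valued.v (g 1 0 : K) ≤ Valued.v (4 : K))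
    {S0 S4 : AddSubgroup K} (hS0 : ∀ x, x ∈ S0 ↔ σ x = -x ∧ Valued.v x ≤ 1) (hS4 : ∀ x, x ∈ S4 ↔ σ x = -x ∧ Valued.v x ≤ Valued.v (4 : K)) :
    K4.relIndex H1 = S4.relIndex S0 := by
  obtain ⟨n, -, hn⟩ := exists_upperUnipotentHom (K := K)
  have hent : ∀ x : Multiplicative K, ((n x) 0 0 : K) = 1 ∧ ((n x) 0 1 : K) = Multiplicative.toAdd x ∧ ((n x) 1 0 : K) = 0 ∧ ((n x) 1 1 : K) = 1 :=
    fun x => apply_eq_of_coe_eq (hn x)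
  have hint : ∀ x : Multiplicative K, Valued.v (Multiplicative.toAdd x) ≤ 1 → ∀ i j, Valued.v ((n x) i j : K) ≤ 1 := fun x hx i j => by
    obtain ⟨e00, e01, e10, e11⟩ := hent x
    fin_cases i <;> fin_cases j
    · simp [e00]
    · simpa [e01] using hx
    · simp [e10]
    · simp [e11]
  rw [← AddSubgroup.relIndex_toSubgroup]
  refine relIndex_eq_relIndex_of_mul_decomposition n (AddSubgroup.toSubgroup S4) (AddSubgroup.toSubgroup S0) K4 H1 ?_ ?_ ?_
  · -- `n(𝒪⁻) ⊆ H₁`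
    intro b hb
    rw [Multiplicative.mem_toSubgroup, hS0] at hb
    obtain ⟨e00, -, e10, e11⟩ := hent b
    refine (hH1 _).2 ⟨⟨(upper_mem_unitaryGroupOfForm_antidiagTwo_iff σ (hn b)).2 hb.1, hint b hb.2⟩, ?_, ?_, ?_⟩
    · rw [e00, sub_self, map_zero]; exact zero_le
    · rw [e11, sub_self, map_zero]; exact zero_le
    · rw [e10, map_zero]; exact zero_le
  · -- `n(x) ∈ K(4) ↔ x ∈ (4𝒪)⁻` on `𝒪⁻`
    intro b hb
    rw [Multiplicative.mem_toSubgroup, hS0] at hb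
    rw [Multiplicative.mem_toSubgroup, hS4, hK4]
    obtain ⟨e00, e01, e10, e11⟩ := hent b
    constructor
    · rintro ⟨-, h⟩
      refine ⟨hb.1, ?_⟩
      have h01 := h 0 1
      rwa [e01, Matrix.one_apply_ne (show (0 : Fin 2) ≠ 1 by decide), sub_zero] at h01
    · rintro ⟨-, h⟩
      refine ⟨⟨(upper_mem_unitaryGroupOfForm_antidiagTwo_iff σ (hn b)).2 hb.1, hint b hb.2⟩, fun i j => ?_⟩
      fin_cases i <;> fin_cases j
      · show Valued.v (((n b) 0 0 : K) - (1 : Matrix (Fin 2) (Fin 2) K) 0 0) ≤ Valued.v (4 : K)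
        rw [e00, Matrix.one_apply_eq, sub_self, map_zero]; exact zero_le
      · show Valued.v (((n b) 0 1 : K) - (1 : Matrix (Fin 2) (Fin 2) K) 0 1) ≤ Valued.v (4 : K)
        rw [e01, Matrix.one_apply_ne (show (0 : Fin 2) ≠ 1 by decide), sub_zero]; exact h
      · show Valued.v (((n b) 1 0 : K) - (1 : Matrix (Fin 2) (Fin 2) K) 1 0) ≤ Valued.v (4 : K)
        rw [e10, Matrix.one_apply_ne (show (1 : Fin 2) ≠ 0 by decide), sub_zero, map_zero]; exact zero_le
      · show Valued.v (((n b) 1 1 : K) - (1 : Matrix (Fin 2) (Fin 2) K) 1 1) ≤ Valued.v (4 : K)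
        rw [e11, Matrix.one_apply_eq, sub_self, map_zero]; exact zero_le
  · -- `H₁ ⊆ n(𝒪⁻)·K(4)`
    intro h hh
    obtain ⟨⟨hU, hi⟩, h00, h11, h10⟩ := (hH1 h).1 hh
    obtain ⟨-, -, -, rel4⟩ := antidiagTwo_entry_relations σ hU
    have hd1 : Valued.v (h 1 1 : K) = 1 := UnitaryLatticeTree.v_eq_one_of_v_sub_one_lt_one (h11.trans_lt h4)
    have hd0 : (h 1 1 : K) ≠ 0 := fun h0 => by rw [h0, map_zero] at hd1; exact zero_ne_one hd1
    have hσd0 : σ (h 1 1) ≠ 0 := (map_ne_zero σ).2 hd0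
    set x : K := (h 0 1 : K) / (h 1 1 : K) with hx
    have hxσ : σ x = -x := by
      rw [hx, map_div₀, ← neg_div, div_eq_div_iff hσd0 hd0]
      linear_combination rel4
    have hxv : Valued.v x ≤ 1 := by rw [hx, map_div₀, hd1, div_one]; exact hi 0 1
    refine ⟨Multiplicative.ofAdd x, by rw [Multiplicative.mem_toSubgroup, hS0, toAdd_ofAdd]; exact ⟨hxσ, hxv⟩, ?_⟩
    rw [← map_inv, ← ofAdd_neg]
    obtain ⟨e00, e01, e10, e11⟩ := hent (Multiplicative.ofAdd (-x))
    rw [toAdd_ofAdd] at e01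
    have hnU : n (Multiplicative.ofAdd (-x)) ∈ unitaryGroupOfForm σ !![(0 : K), 1; 1, 0] :=
      (upper_mem_unitaryGroupOfForm_antidiagTwo_iff σ (hn _)).2 (by rw [toAdd_ofAdd, map_neg, hxσ])
    have hnint : ∀ i j, Valued.v ((n (Multiplicative.ofAdd (-x))) i j : K) ≤ 1 := hint _ (by rw [toAdd_ofAdd, Valuation.map_neg]; exact hxv)
    refine (hK4 _).2 ⟨⟨Subgroup.mul_mem _ hnU hU, valued_coe_mul_apply_le_one hnint hi⟩, fun i j => ?_⟩
    fin_cases i <;> fin_cases j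
    · show Valued.v (((n (Multiplicative.ofAdd (-x)) * h : GL (Fin 2) K) 0 0 : K) - (1 : Matrix (Fin 2) (Fin 2) K) 0 0) ≤ Valued.v (4 : K)
      rw [coe_mul_apply_two, e00, e01, Matrix.one_apply_eq, show (1 : K) * h 0 0 + -x * h 1 0 - 1 = ((h 0 0 : K) - 1) + -(x * h 1 0) by ring]
      refine (Valuation.map_add _ _ _).trans (max_le h00 ?_)
      rw [Valuation.map_neg, map_mul]; exact (mul_le_of_le_one_left' hxv).trans h10
    · show Valued.v (((n (Multiplicative.ofAdd (-x)) * h : GL (Fin 2) K) 0 1 : K) - (1 : Matrix (Fin 2) (Fin 2) K) 0 1) ≤ Valued.v (4 : K)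
      rw [coe_mul_apply_two, e00, e01, Matrix.one_apply_ne (show (0 : Fin 2) ≠ 1 by decide), hx, show (1 : K) * h 0 1 + -((h 0 1 : K) / h 1 1) * h 1 1 - 0 = 0 by rw [neg_mul, div_mul_cancel₀ _ hd0]; ring,
        map_zero]
      exact zero_le
    · show Valued.v (((n (Multiplicative.ofAdd (-x)) * h : GL (Fin 2) K) 1 0 : K) - (1 : Matrix (Fin 2) (Fin 2) K) 1 0) ≤ Valued.v (4 : K)
      rw [coe_mul_apply_two, e10, e11, Matrix.one_apply_ne (show (1 : Fin 2) ≠ 0 by decide), zero_mul, zero_add, one_mul, sub_zero]; exact h10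
    · show Valued.v (((n (Multiplicative.ofAdd (-x)) * h : GL (Fin 2) K) 1 1 : K) - (1 : Matrix (Fin 2) (Fin 2) K) 1 1) ≤ Valued.v (4 : K)
      rw [coe_mul_apply_two, e10, e11, Matrix.one_apply_eq, zero_mul, zero_add, one_mul]; exact h11

/-! ## §2 `[B(4) : N(𝒪⁻)K(4)] = [𝒪^× : 1 + 4𝒪]` -/

include hσ hvσ in
/-- **`[B(4) : N(𝒪⁻)·K(4)] = [𝒪^× : 1 + 4𝒪]`** (`|4| < 1`): the step `H₁ ≤ H₂` is `H₂ = t(𝒪^×)·H₁` with `t(e) ∈ H₁ ↔ |e − 1| ≤ |4|` — for `h = (a b; c d) ∈ B(4)` the corner `a` is a unit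
(`|c| < 1`, ★ `valued_apply_zero_zero_eq_one_or_of_integral`) and `t(a)⁻¹·h = (1, b∕a; σa·c, σa·d)` with `σa·d − 1 = −σc·b ≡ 0 (4)`. [cite: Tits1979, §3.3.1] [cite: Serre1979, Ch. IV §2] -/
theorem relIndex_unitriangularLevel_borelLevel_eq (h4 : Valued.v (4 : K) < 1) {H1 H2 : Subgroup (GL (Fin 2) K)}
    (hH1 : ∀ g, g ∈ H1 ↔ (g ∈ unitaryGroupOfForm σ !![(0 : K), 1; 1, 0] ∧ ∀ i j, Valued.v (g i j : K) ≤ 1) ∧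
      Valued.v ((g 0 0 : K) - 1) ≤ Valued.v (4 : K) ∧ Valued.v ((g 1 1 : K) - 1) ≤ Valued.v (4 : K) ∧ Valued.v (g 1 0 : K) ≤ Valued.v (4 : K))
    (hH2 : ∀ g, g ∈ H2 ↔ (g ∈ unitaryGroupOfForm σ !![(0 : K), 1; 1, 0] ∧ ∀ i j, Valued.v (g i j : K) ≤ 1) ∧ Valued.v (g 1 0 : K) ≤ Valued.v (4 : K))
    {U1 U4 : Subgroup Kˣ} (hU1 : ∀ e : Kˣ, e ∈ U1 ↔ Valued.v (e : K) = 1) (hU4 : ∀ e : Kˣ, e ∈ U4 ↔ Valued.v (e : K) = 1 ∧ Valued.v ((e : K) - 1) ≤ Valued.v (4 : K)) :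
    H1.relIndex H2 = U4.relIndex U1 := by
  obtain ⟨t, -, ht⟩ := exists_torusHom σ
  have hent : ∀ e : Kˣ, ((t e) 0 0 : K) = e ∧ ((t e) 0 1 : K) = 0 ∧ ((t e) 1 0 : K) = 0 ∧ ((t e) 1 1 : K) = (σ e)⁻¹ := fun e => apply_eq_of_coe_eq (ht e)
  have hint : ∀ e : Kˣ, Valued.v (e : K) = 1 → ∀ i j, Valued.v ((t e) i j : K) ≤ 1 := fun e he i j => by
    obtain ⟨e00, e01, e10, e11⟩ := hent e
    fin_cases i <;> fin_cases j
    · simp [e00, he]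
    · simp [e01]
    · simp [e10]
    · simp [e11, map_inv₀, hvσ, he]
  refine relIndex_eq_relIndex_of_mul_decomposition t U4 U1 H1 H2 ?_ ?_ ?_
  · -- `t(𝒪^×) ⊆ H₂`
    intro e he
    rw [hU1] at he
    obtain ⟨-, -, e10, -⟩ := hent e
    exact (hH2 _).2 ⟨⟨torus_mem_unitaryGroupOfForm_antidiagTwo σ hσ e (ht e), hint e he⟩, by rw [e10, map_zero]; exact zero_le⟩
  · -- `t(e) ∈ H₁ ↔ |e − 1| ≤ |4|` on `𝒪^×`
    intro e he
    rw [hU1] at he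
    obtain ⟨e00, -, e10, e11⟩ := hent e
    rw [hH1, hU4, e00, e11, e10, valued_inv_map_sub_one_eq σ hvσ he, map_zero]
    exact ⟨fun h => ⟨he, h.2.1⟩, fun h => ⟨⟨torus_mem_unitaryGroupOfForm_antidiagTwo σ hσ e (ht e), hint e he⟩, h.2, h.2, zero_le⟩⟩
  · -- `H₂ ⊆ t(𝒪^×)·H₁`
    intro h hh
    obtain ⟨⟨hU, hi⟩, h10⟩ := (hH2 h).1 hh
    obtain ⟨-, rel2, -, -⟩ := antidiagTwo_entry_relations σ hU
    have ha1 : Valued.v (h 0 0 : K) = 1 := by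
      rcases valued_apply_zero_zero_eq_one_or_of_integral σ hvσ hU hi with h | h
      · exact h
      · exact absurd h (h10.trans_lt h4).ne
    have ha0 : (h 0 0 : K) ≠ 0 := fun h0 => by rw [h0, map_zero] at ha1; exact zero_ne_one ha1
    refine ⟨Units.mk0 _ ha0, by rw [hU1, Units.val_mk0]; exact ha1, ?_⟩
    rw [← map_inv]
    obtain ⟨e00, e01, e10, e11⟩ := hent (Units.mk0 _ ha0)⁻¹
    have hinv : (((Units.mk0 (h 0 0 : K) ha0)⁻¹ : Kˣ) : K) = (h 0 0 : K)⁻¹ := by rw [Units.val_inv_eq_inv_val, Units.val_mk0]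
    rw [hinv] at e00 e11
    rw [map_inv₀, inv_inv] at e11
    have htU : t (Units.mk0 _ ha0)⁻¹ ∈ unitaryGroupOfForm σ !![(0 : K), 1; 1, 0] := torus_mem_unitaryGroupOfForm_antidiagTwo σ hσ _ (ht _)
    have htint : ∀ i j, Valued.v ((t (Units.mk0 _ ha0)⁻¹) i j : K) ≤ 1 := hint _ (by rw [hinv, map_inv₀, ha1, inv_one])
    refine (hH1 _).2 ⟨⟨Subgroup.mul_mem _ htU hU, valued_coe_mul_apply_le_one htint hi⟩, ?_, ?_, ?_⟩
    · rw [coe_mul_apply_two, e00, e01, zero_mul, add_zero, inv_mul_cancel₀ ha0, sub_self, map_zero]; exact zero_le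
    · rw [coe_mul_apply_two, e10, e11, zero_mul, zero_add, show σ (h 0 0) * (h 1 1 : K) - 1 = -(σ (h 1 0) * h 0 1) by linear_combination rel2, Valuation.map_neg, map_mul, hvσ]
      exact (mul_le_of_le_one_right' (hi 0 1)).trans h10
    · rw [coe_mul_apply_two, e10, e11, zero_mul, zero_add, map_mul, hvσ, ha1, one_mul]; exact h10

/-! ## §3 `[I : B(4)] = [𝔪⁻ : (4𝒪)⁻]` -/

include hvσ in
/-- **`[I : B(4)] = [𝔪⁻ : (4𝒪)⁻]`** (`|4| < 1`): the step `H₂ ≤ I` is `I = n̄(𝔪⁻)·H₂` with `n̄(x) ∈ B(4) ↔ |x| ≤ |4|` — for `k = (a b; c d) ∈ I` (`|c| < 1`, so `|a| = 1`), `x = c∕a` is skew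
(`σa·c + σc·a = 0`) with `|x| < 1`, and `n̄(x)⁻¹·k = (a b; 0, d − xb)` is upper triangular. [cite: Tits1979, §3.3.1] [cite: CartierCorvallis1979, §III.5] -/
theorem relIndex_borelLevel_iwahori_eq {H2 I : Subgroup (GL (Fin 2) K)}
    (hH2 : ∀ g, g ∈ H2 ↔ (g ∈ unitaryGroupOfForm σ !![(0 : K), 1; 1, 0] ∧ ∀ i j, Valued.v (g i j : K) ≤ 1) ∧ Valued.v (g 1 0 : K) ≤ Valued.v (4 : K))
    (hI : ∀ g, g ∈ I ↔ (g ∈ unitaryGroupOfForm σ !![(0 : K), 1; 1, 0] ∧ ∀ i j, Valued.v (g i j : K) ≤ 1) ∧ Valued.v (g 1 0 : K) < 1)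
    {Sm S4 : AddSubgroup K} (hSm : ∀ x, x ∈ Sm ↔ σ x = -x ∧ Valued.v x < 1) (hS4 : ∀ x, x ∈ S4 ↔ σ x = -x ∧ Valued.v x ≤ Valued.v (4 : K)) :
    H2.relIndex I = S4.relIndex Sm := by
  obtain ⟨n, -, hn⟩ := exists_lowerUnipotentHom (K := K)
  have hent : ∀ x : Multiplicative K, ((n x) 0 0 : K) = 1 ∧ ((n x) 0 1 : K) = 0 ∧ ((n x) 1 0 : K) = Multiplicative.toAdd x ∧ ((n x) 1 1 : K) = 1 :=
    fun x => apply_eq_of_coe_eq (hn x)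
  have hint : ∀ x : Multiplicative K, Valued.v (Multiplicative.toAdd x) ≤ 1 → ∀ i j, Valued.v ((n x) i j : K) ≤ 1 := fun x hx i j => by
    obtain ⟨e00, e01, e10, e11⟩ := hent x
    fin_cases i <;> fin_cases j
    · simp [e00]
    · simp [e01]
    · simpa [e10] using hx
    · simp [e11]
  rw [← AddSubgroup.relIndex_toSubgroup]
  refine relIndex_eq_relIndex_of_mul_decomposition n (AddSubgroup.toSubgroup S4) (AddSubgroup.toSubgroup Sm) H2 I ?_ ?_ ?_
  · -- `n̄(𝔪⁻) ⊆ I`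
    intro b hb
    rw [Multiplicative.mem_toSubgroup, hSm] at hb
    obtain ⟨-, -, e10, -⟩ := hent b
    exact (hI _).2 ⟨⟨(lower_mem_unitaryGroupOfForm_antidiagTwo_iff σ (hn b)).2 hb.1, hint b hb.2.le⟩, by rw [e10]; exact hb.2⟩
  · -- `n̄(x) ∈ B(4) ↔ |x| ≤ |4|` on `𝔪⁻`
    intro b hb
    rw [Multiplicative.mem_toSubgroup, hSm] at hb
    obtain ⟨-, -, e10, -⟩ := hent b
    rw [Multiplicative.mem_toSubgroup, hS4, hH2, e10]
    exact ⟨fun h => ⟨hb.1, h.2⟩, fun h => ⟨⟨(lower_mem_unitaryGroupOfForm_antidiagTwo_iff σ (hn b)).2 hb.1, hint b hb.2.le⟩, h.2⟩⟩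
  · -- `I ⊆ n̄(𝔪⁻)·B(4)`
    intro k hk
    obtain ⟨⟨hU, hi⟩, hc⟩ := (hI k).1 hk
    obtain ⟨rel1, -, -, -⟩ := antidiagTwo_entry_relations σ hU
    have ha1 : Valued.v (k 0 0 : K) = 1 := by
      rcases valued_apply_zero_zero_eq_one_or_of_integral σ hvσ hU hi with h | h
      · exact h
      · exact absurd h hc.ne
    have ha0 : (k 0 0 : K) ≠ 0 := fun h0 => by rw [h0, map_zero] at ha1; exact zero_ne_one ha1
    have hσa0 : σ (k 0 0) ≠ 0 := (map_ne_zero σ).2 ha0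
    set x : K := (k 1 0 : K) / (k 0 0 : K) with hx
    have hxσ : σ x = -x := by
      rw [hx, map_div₀, ← neg_div, div_eq_div_iff hσa0 ha0]
      linear_combination rel1
    have hxv : Valued.v x < 1 := by rw [hx, map_div₀, ha1, div_one]; exact hc
    refine ⟨Multiplicative.ofAdd x, by rw [Multiplicative.mem_toSubgroup, hSm, toAdd_ofAdd]; exact ⟨hxσ, hxv⟩, ?_⟩
    rw [← map_inv, ← ofAdd_neg]
    obtain ⟨e00, e01, e10, e11⟩ := hent (Multiplicative.ofAdd (-x))
    rw [toAdd_ofAdd] at e10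
    have hnU : n (Multiplicative.ofAdd (-x)) ∈ unitaryGroupOfForm σ !![(0 : K), 1; 1, 0] :=
      (lower_mem_unitaryGroupOfForm_antidiagTwo_iff σ (hn _)).2 (by rw [toAdd_ofAdd, map_neg, hxσ])
    have hnint : ∀ i j, Valued.v ((n (Multiplicative.ofAdd (-x))) i j : K) ≤ 1 := hint _ (by rw [toAdd_ofAdd, Valuation.map_neg]; exact hxv.le)
    refine (hH2 _).2 ⟨⟨Subgroup.mul_mem _ hnU hU, valued_coe_mul_apply_le_one hnint hi⟩, ?_⟩
    rw [coe_mul_apply_two, e10, e11, hx, one_mul, show -((k 1 0 : K) / k 0 0) * k 0 0 + k 1 0 = 0 by rw [neg_mul, div_mul_cancel₀ _ ha0, neg_add_cancel], map_zero]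
    exact zero_le

/-! ## §4 The product `[I : K(4)] = [𝔪⁻ : (4𝒪)⁻] · [𝒪^× : 1 + 4𝒪] · [𝒪⁻ : (4𝒪)⁻]` -/

include hσ hvσ in
/-- **THE IWAHORI LEVEL COUNT IN ABELIAN CURRENCY: `[I : K(4)] = [𝔪⁻ : (4𝒪)⁻] · [𝒪^× : 1 + 4𝒪] · [𝒪⁻ : (4𝒪)⁻]`** for `U(σ, antidiag(1,1))` over a valued field with an isometric involution
`σ` and `|4| < 1` (`I = {k ∈ U(𝒪) : |k₁₀| < 1}`, `K(4) = {k ∈ U(𝒪) : k ≡ 1 (4)}`; skew balls and unit levels as membership letters).  The three factors are §3, §2, §1 along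
`K(4) ≤ N(𝒪⁻)K(4) ≤ B(4) ≤ I` (★ FILE 1 existence + chain).  At a wild CM place they are `q^{2m−1+s}`, `(q−1)q^{4m−1}`, `q^{2m}` (FILE 3). [cite: Tits1979, §3.3.1, §3.7]
[cite: CartierCorvallis1979, §III.5] [cite: Serre1979, Ch. IV §2 Prop. 6] -/
theorem relIndex_principalLevel_iwahori_eq_mul (h4 : Valued.v (4 : K) < 1) {K4 I : Subgroup (GL (Fin 2) K)}
    (hK4 : ∀ g, g ∈ K4 ↔ (g ∈ unitaryGroupOfForm σ !![(0 : K), 1; 1, 0] ∧ ∀ i j, Valued.v (g i j : K) ≤ 1) ∧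
      ∀ i j, Valued.v ((g i j : K) - (1 : Matrix (Fin 2) (Fin 2) K) i j) ≤ Valued.v (4 : K))
    (hI : ∀ g, g ∈ I ↔ (g ∈ unitaryGroupOfForm σ !![(0 : K), 1; 1, 0] ∧ ∀ i j, Valued.v (g i j : K) ≤ 1) ∧ Valued.v (g 1 0 : K) < 1)
    {S0 Sm S4 : AddSubgroup K} (hS0 : ∀ x, x ∈ S0 ↔ σ x = -x ∧ Valued.v x ≤ 1) (hSm : ∀ x, x ∈ Sm ↔ σ x = -x ∧ Valued.v x < 1)
    (hS4 : ∀ x, x ∈ S4 ↔ σ x = -x ∧ Valued.v x ≤ Valued.v (4 : K))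
    {U1 U4 : Subgroup Kˣ} (hU1 : ∀ e : Kˣ, e ∈ U1 ↔ Valued.v (e : K) = 1) (hU4 : ∀ e : Kˣ, e ∈ U4 ↔ Valued.v (e : K) = 1 ∧ Valued.v ((e : K) - 1) ≤ Valued.v (4 : K)) :
    K4.relIndex I = S4.relIndex Sm * U4.relIndex U1 * S4.relIndex S0 := by
  obtain ⟨H1, hH1⟩ := exists_subgroup_unitriangularLevel σ hvσ
  obtain ⟨H2, hH2⟩ := exists_subgroup_borelLevel σ hvσ
  obtain ⟨h41, h12, h2I⟩ := principalLevel_le_unitriangularLevel_le_borelLevel_le_iwahori σ h4 hK4 hH1 hH2 hI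
  rw [← Subgroup.relIndex_mul_relIndex K4 H1 I h41 (h12.trans h2I), ← Subgroup.relIndex_mul_relIndex H1 H2 I h12 h2I,
    relIndex_principalLevel_unitriangularLevel_eq σ h4 hK4 hH1 hS0 hS4, relIndex_unitriangularLevel_borelLevel_eq σ hσ hvσ h4 hH1 hH2 hU1 hU4,
    relIndex_borelLevel_iwahori_eq σ hvσ hH2 hI hSm hS4]
  ring

end Indices

end UnitaryGroup

end Literature.NumberTheory.Automorphic
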